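/-
Copyright: pub-balaban β-flow team, β-FLOW PROVER 4 (unit `b2b-balaban-beta-bflow-p4`, gen 9; coordinator ruling «YM
ACCELERATION» 2026-08-21 item (2), «work behind the as-printed interface»).  NON-VACUITY of PART 21d: one explicit `Setting`
(vacuum polarization := half an2's Maxwell kernel, quadratic part := the (3.67) double sum, ‖∂B‖² := the unit-weight curl form,
admissible := the slowly-varying class N-adm′, ζ := the second moment) meets EVERY hypothesis of `d365_of_decay510`, hence
`Definitions`.  [folklore]; nothing of Bałaban's asserted; NOT BetaPertH, NOT continuum, NOT Clay.
-/
import Mathlib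
import Summits.QuantumFields.BalabanUV.Beta.EriceZetaIdentificationWitnessEnd
import Summits.QuantumFields.BalabanUV.Beta.EriceQuadraticFormDecompositionEnd

/-!
# `Beta.EriceQuadraticFormDecompositionWitness` — PART 21e of the `EriceLoopExpansionD4` series: the binder list of
# `d365_of_decay510` is inhabited by a non-zero kernel and a non-trivial admissible class

Source: T. Bałaban, A. Jaffe, *Constructive gauge theory* (Erice 1985) [BalabanJaffe1986], Part III p. 249 (3.65)–(3.68); the
interface `BetaFlowAsPrinted` (p280233); PART 21d `Beta.EriceQuadraticFormDecompositionEnd` (`d365_of_decay510`,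
`definitions_of_kernel`, `c368_of_secondMoment`).  The kernel is an2's infinite-volume lattice Maxwell kernel halved, `½Π^ℤ`
(`PolarizationWitnessZd.maxwellKernelZ 4`; PART 17c ∕ 17d: it carries (5.7)–(5.10), (1.21), its mixed second moment is `1`); NOT
Bałaban's Π^{(j)}.

WHAT IS KERNEL-CHECKED HERE (def-free, [folklore]):
* §1 `axisReflectionCovariant_halfMaxwell`, `decay510_halfMaxwell` — the two kernel properties PART 21d asks beyond PART 17d's list.
* §2 **`hypotheses_inhabited`** — a `Setting S` with `vacPol j s := ½Π^ℤ`, `quad` := the d367 double sum, `halfCurlSq` := N-curl,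
  `ζ j s := secondMoment (½Π^ℤ) 0 1 (= 1)`, `adm j` := N-adm′ with `K = k₁ = k₂ = 1` (support over a `T` with `#T ≤ sites j := 16`,
  unit steps `≤ (L^jη)² := 1`, second differences `≤ (L^jη)^{2+α} = 1`), `α := 1`, `C365 := 96·M(½Π^ℤ)`: ALL hypotheses of `d365_of_decay510`
  hold, so `Definitions.d365` and `Definitions S` follow BY THAT THEOREM, `Conclusions.c368`'s conjunct holds by
  `c368_of_secondMoment`, the kernel is non-zero and `adm 1` contains a non-zero field (the indicator of one bond).
HONEST: a consistency witness for typed hypothesis lists; Π^ℤ is the free Maxwell kernel, NOT Bałaban's Π^{(j)}; NOT B12 Thm 2,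
NOT BetaPertH, NOT continuum, NOT Clay.  HONEST DEPENDENCY: continuum YM on T⁴ ⇐ BetaPertH ∧ nine spine estimates (0/9
proved); BetaPertH ⇐ (D1) ∧ (D4) ∧ CAP+tail; G-an2-4 gates asym, D1 and NE2/3/4.
-/

namespace Summit.QuantumFields.BalabanUV.Beta.EriceQuadraticFormDecompositionWitness

open scoped BigOperators
open Literature.MathematicalPhysics.QuantumFieldTheory.Balaban1983to89
open Literature.MathematicalPhysics.QuantumFieldTheory.Balaban1983to89.Beta
open Literature.MathematicalPhysics.QuantumFieldTheory.Balaban1983to89.B12Sec2to5 (Decay510 l1)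
open Literature.MathematicalPhysics.QuantumFieldTheory.Balaban1983to89.Beta.PolarizationSign (size MomentSummable
  WardTransversal IndexSymmetric AxisReflectionCovariant axisReflect)
open Literature.MathematicalPhysics.QuantumFieldTheory.Balaban1983to89.Beta.PolarizationWitnessZd
open Literature.MathematicalPhysics.QuantumFieldTheory.Balaban1983to89.B6BondElimination (unitVec unitVec_apply)
open Literature.MathematicalPhysics.QuantumFieldTheory.BalabanJaffe1986
open Literature.MathematicalPhysics.QuantumFieldTheory.BalabanJaffe1986.BJ86EffectiveAction
open Literature.MathematicalPhysics.QuantumFieldTheory.BalabanJaffe1986.BetaFlowAsPrinted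
open Summit.QuantumFields.BalabanUV.Beta.EriceZetaIdentificationWitnessEnd (momentSummable_halfMaxwell
  wardTransversal_halfMaxwell indexSymmetric_halfMaxwell permCovariant_halfMaxwell secondMoment_halfMaxwell_eq_one)
open Summit.QuantumFields.BalabanUV.Beta.EriceQuadraticFormDecompositionEnd

/-! ## §1. Two more properties of the halved Maxwell kernel -/

/-- (5.7)-shape for `½Π^ℤ`. [folklore] -/
theorem axisReflectionCovariant_halfMaxwell : AxisReflectionCovariant (fun μ ν z => 1 / 2 * maxwellKernelZ 4 μ ν z) :=
  fun α μ ν z => by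
    have h := axisReflectionCovariant_maxwellKernelZ (d := 4) α μ ν z
    show 1 / 2 * maxwellKernelZ 4 μ ν _ = _
    rw [h]; ring

/-- (5.10)-shape for `½Π^ℤ` with rate `1` (an2's constant `8(d+1)e²` kept): `Decay510 (½Π^ℤ_{μν}) (8·5·e²) 1`. [folklore] -/
theorem decay510_halfMaxwell (μ ν : Fin 4) :
    Decay510 (fun z => 1 / 2 * maxwellKernelZ 4 μ ν z) (8 * ((4 : ℕ) + 1) * Real.exp (2 * 1)) 1 := fun x => by
  have h := decay510_maxwellKernelZ (d := 4) zero_le_one μ ν x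
  calc |1 / 2 * maxwellKernelZ 4 μ ν x| = 1 / 2 * |maxwellKernelZ 4 μ ν x| := by
        rw [abs_mul, abs_of_pos (by norm_num : (0 : ℝ) < 1 / 2)]
    _ ≤ |maxwellKernelZ 4 μ ν x| := by linarith [abs_nonneg (maxwellKernelZ 4 μ ν x)]
    _ ≤ _ := h

/-! ## §2. The witness -/

/-- **NON-VACUITY OF PART 21d**: an explicit `Setting` whose vacuum polarization is the NON-ZERO kernel `½Π^ℤ`, whose admissible
class at every step is the slowly-varying class N-adm′ (K = k₁ = k₂ = 1, `sites j = 16`, `L^jη` read as 1) and contains a NON-ZERO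
field, and which satisfies EVERY hypothesis of `d365_of_decay510`; consequently `Definitions S` holds (via `definitions_of_kernel`)
and `Conclusions.c368`'s conjunct holds (via `c368_of_secondMoment`). [folklore] -/
theorem hypotheses_inhabited :
    ∃ S : Setting, Definitions S ∧
      (∀ j s, S.vacPol j s = fun μ ν z => 1 / 2 * maxwellKernelZ 4 μ ν z) ∧
      (∀ (j : ℕ), 1 ≤ j → ∀ s ∈ Set.Icc 0 S.s0, ∀ μ ν : Fin 4, μ ≠ ν →
        (S.ζ j s : ℂ) = -mixedDeriv0 (fourierT (S.vacPol j s μ ν)) μ ν) ∧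
      (∃ B : Fld, B ≠ 0 ∧ B ∈ S.adm 1) := by
  classical
  let adm : ℕ → Set Fld := fun _ => {B | ∃ T : Finset (Fin 4 → ℤ), (∀ a ∈ B.support, a.1 ∈ T) ∧
      (T.card : ℝ) ≤ 1 * 16 ∧
      (∀ (μ α : Fin 4) (y : Fin 4 → ℤ), |B (y + unitVec α, μ) - B (y, μ)| ≤ 1 * (1 : ℝ) ^ 2) ∧
      (∀ (μ α β : Fin 4) (y : Fin 4 → ℤ),
        |B (y + unitVec α + unitVec β, μ) - B (y + unitVec α, μ) - B (y + unitVec β, μ) + B (y, μ)|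
          ≤ 1 * (1 : ℝ) ^ ((2 : ℝ) + 1))}
  let M : ℝ := (8 * ((4 : ℕ) + 1) * Real.exp (2 * 1)) * (((3 : ℕ).factorial : ℝ) * Real.exp (1 / 2) / (1 / 2) ^ 3)
    * ∑' z : Fin 4 → ℤ, Real.exp (-(1 / 2) * l1 z)
  let S : Setting :=
    { L := 2
      Cfg := Unit
      Dom := Unit
      E := ⟨fun _ => ∅, fun _ => 0, fun _ _ _ => 0⟩
      C333 := 0
      κ := 0
      h1bAnalyticExtension := True
      a := 1
      p := 5
      s0 := 1
      h3Regularity347 := True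
      h5GaugeInvariantDifferentiable := True
      h6Semisimple := True
      βΛ := fun _ _ => B12Beta.secondMoment (fun μ ν z => 1 / 2 * maxwellKernelZ 4 μ ν z) 0 1
      βE := fun _ _ => B12Beta.secondMoment (fun μ ν z => 1 / 2 * maxwellKernelZ 4 μ ν z) 0 1
      adm := adm
      quad := fun _ _ B => (1 / 2 : ℝ) *
        B.sum (fun a ba => B.sum (fun b bb => ba * (1 / 2 * maxwellKernelZ 4 a.2 b.2 (a.1 - b.1)) * bb))
      halfCurlSq := fun B => (1 / 4) * ∑' x : Fin 4 → ℤ, ∑ μ, ∑ ν,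
        (B (x, μ) + B (x + unitVec μ, ν) - B (x + unitVec ν, μ) - B (x, ν)) ^ 2
      sites := fun _ => 16
      r := fun _ => 1
      ζ := fun _ _ => B12Beta.secondMoment (fun μ ν z => 1 / 2 * maxwellKernelZ 4 μ ν z) 0 1
      α := 1
      C365 := 96 * M * 1 * 1 * 1
      vacPol := fun _ _ μ ν z => 1 / 2 * maxwellKernelZ 4 μ ν z }
  have hquad : ∀ (j : ℕ) (s : ℝ) (B : Fld), 1 ≤ j → B ∈ S.adm j →
      S.quad j s B = (1 / 2 : ℝ) * B.sum (fun a ba => B.sum (fun b bb => ba * S.vacPol j s a.2 b.2 (a.1 - b.1) * bb)) :=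
    fun _ _ _ _ _ => rfl
  have hcurl : ∀ (j : ℕ) (B : Fld), 1 ≤ j → B ∈ S.adm j → S.halfCurlSq B = (1 / 4) * ∑' x : Fin 4 → ℤ, ∑ μ, ∑ ν,
      (B (x, μ) + B (x + unitVec μ, ν) - B (x + unitVec ν, μ) - B (x, ν)) ^ 2 := fun _ _ _ _ => rfl
  have hζ : ∀ (j : ℕ) (s : ℝ), 1 ≤ j → s ∈ Set.Icc 0 S.s0 → S.ζ j s = B12Beta.secondMoment (S.vacPol j s) 0 1 :=
    fun _ _ _ _ => rfl
  have hker : ∀ (j : ℕ) (s : ℝ), 1 ≤ j → s ∈ Set.Icc 0 S.s0 →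
      (∀ μ ν, Decay510 (S.vacPol j s μ ν) (8 * ((4 : ℕ) + 1) * Real.exp (2 * 1)) 1) ∧ WardTransversal (S.vacPol j s) ∧
        AxisReflectionCovariant (S.vacPol j s) ∧ IndexSymmetric (S.vacPol j s) ∧ B12Beta.PermCovariant (S.vacPol j s) :=
    fun _ _ _ _ => ⟨decay510_halfMaxwell, wardTransversal_halfMaxwell, axisReflectionCovariant_halfMaxwell,
      indexSymmetric_halfMaxwell, permCovariant_halfMaxwell⟩
  have hadm : ∀ (j : ℕ), 1 ≤ j → ∀ B ∈ S.adm j, ∃ T : Finset (Fin 4 → ℤ), (∀ a ∈ B.support, a.1 ∈ T) ∧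
      (T.card : ℝ) ≤ 1 * S.sites j ∧
      (∀ (μ α : Fin 4) (y : Fin 4 → ℤ), |B (y + unitVec α, μ) - B (y, μ)| ≤ 1 * S.r j ^ 2) ∧
      (∀ (μ α β : Fin 4) (y : Fin 4 → ℤ),
        |B (y + unitVec α + unitVec β, μ) - B (y + unitVec α, μ) - B (y + unitVec β, μ) + B (y, μ)|
          ≤ 1 * S.r j ^ (2 + S.α)) :=
    fun _ _ _ hB => hB
  have h365 := d365_of_decay510 S hquad hcurl hζ one_pos hker zero_le_one zero_le_one hadm
    (fun _ _ => ⟨zero_le_one, le_rfl⟩) (fun _ _ => by norm_num [S]) one_pos le_rfl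
  have hD : Definitions S := definitions_of_kernel S (fun _ _ => rfl) (fun _ _ => rfl) hquad h365
  refine ⟨S, hD, fun _ _ => rfl, fun j hj s hs μ ν hμν =>
    c368_of_secondMoment S (hζ j s hj hs) momentSummable_halfMaxwell permCovariant_halfMaxwell hμν, ?_⟩
  -- a non-zero admissible field: a quarter of the indicator of the bond (0, e₀)
  have hb : ∀ q : (Fin 4 → ℤ) × Fin 4, |(Finsupp.single ((0 : Fin 4 → ℤ), (0 : Fin 4)) (1 / 4 : ℝ)) q| ≤ 1 / 4 := by
    intro q
    rw [Finsupp.single_apply]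
    split_ifs <;> norm_num
  refine ⟨Finsupp.single ((0 : Fin 4 → ℤ), (0 : Fin 4)) (1 / 4 : ℝ), Finsupp.single_ne_zero.mpr (by norm_num),
    {(0 : Fin 4 → ℤ)}, ?_, by norm_num, ?_, ?_⟩
  · intro a ha
    rw [Finsupp.support_single _ (by norm_num : (1 / 4 : ℝ) ≠ 0), Finset.mem_singleton] at ha
    rw [ha, Finset.mem_singleton]
  · intro μ α y
    refine (abs_sub _ _).trans ?_
    have h1 := hb (y + unitVec α, μ)
    have h2 := hb (y, μ)
    linarith
  · intro μ α β y
    have h1 := hb (y + unitVec α + unitVec β, μ)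
    have h2 := hb (y + unitVec α, μ)
    have h3 := hb (y + unitVec β, μ)
    have h4 := hb (y, μ)
    have e : ∀ a b c e : ℝ, |a - b - c + e| ≤ |a| + |b| + |c| + |e| := fun a b c e => by
      calc |a - b - c + e| = |(a - b) - (c - e)| := by ring_nf
        _ ≤ |a - b| + |c - e| := abs_sub _ _
        _ ≤ (|a| + |b|) + (|c| + |e|) := add_le_add (abs_sub _ _) (abs_sub _ _)
        _ = |a| + |b| + |c| + |e| := by ring
    refine (e _ _ _ _).trans ?_
    rw [Real.one_rpow, mul_one]
    linarith

end Summit.QuantumFields.BalabanUV.Beta.EriceQuadraticFormDecompositionWitness
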